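import Literature.MathematicalPhysics.QuantumFieldTheory.Balaban1983to89.T3AlphaInputsACHistorySplit
import HarnessLib

/-!
# S1a · UV3-NODE §69.2∕§69.3 — THE (α)-SOCKET's (47′)∕(41′) AT THE TRIVIAL HISTORY, IN `BalabanUVClass.Witness` CURRENCY: `lower` ∕ `upper` ∕ `lf ≥ 0` with the
# RUN-`K` main term `β_K·A(U_k(W))`, activities `Pint(triv)`, `cst = −E_k`, `slack = Rm_k`, and `lf` = the non-trivial histories of (41)

Cell `ym3-torus` (YM ladder rung R3 = continuum `SU(2)` Yang–Mills on the three-torus — a RUNG: NOT d = 4, NOT infinite volume, NOT a mass gap, NOT Clay).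
Width seat «width 8» `ym3-torus-px8` (gen 22), FREE px helper on crux `stmt-QuantumFields-20520`, count-neutral, DEFINITION-FREE, default heartbeats; pen «(m2) door»
(px20 g20 09:06:17Z «GO — YOURS»), second brick after ✓`…S1aAlphaActivitySystem` (p819182): the CONTENT half of the door's `lower`∕`upper`∕`lf_nonneg` fields in the ONLY
currency the class file can honestly carry (★★OWNER RULING ym3-torus-plan №80: the main-term coefficient is the RUN's `β_K = (F.scheme ℰp γ).β K = 1∕(g²ε_K)` on the
unit-weight finest-lattice action — after the requested reading repair (R-β1′) `MemOfRun … (prm j)` unfolds to exactly this with `β_j·L^{K−j} = β_K`).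

WHAT (run `K`, level `k`, datum `W : GaugeField (F.P K) k SU(2)`, density `ρ := resDensity F γ K univ k`, background `Umin K k triv`):
* §1 ★★ `lower_of_ineq47` — from the socket's POINTWISE (47′) `Ineq47At D K k`, `MainTermIsAction D` and the window clause «`χ_k = 1` on `PlaqSmall θBal(K−k)`» (inline; (47) p.267 read on the
  datum, UNTYPED as a schema — UV3-NODE §69.2 δ8): on the window `exp(−β_K·wilsonAction4 (Umin W) + Pint K k triv W + (−Ecst K k) − Rm K k) ≤ ρ W` — `Witness.lower`'s SHAPE with
  `β := β_K`, `Σ_X act X (bg W) := Pint(triv)` (= the flattened activity sum of ✓p819182 `activitySystem_of_alpha`), `cst := −Ecst K k`, `slack := Rm K k`.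
* §2 ★★ `upper_of_ineq41` — from the POINTWISE (41′) `Ineq41At D K k`, `MainTermIsAction`, `ChiRange` (`χ ≤ 1`), the opened history functional `LFSum D W` with the R0 clause «the trivial
  region history's weight IS `χ_k(W)`» and «`Zterm(triv) = 0`» (both inline, as the 18916 consumer states them; ✓`…HistorySplit.low_mul_exp_le_up`): for EVERY `W`,
  `ρ W ≤ exp(−β_K·wilsonAction4 (Umin W) + Pint K k triv W + (−Ecst K k) + Rm K k) + lf W` with `lf W := e^{−E_k+Rm_k}·(up W − low W) ≥ 0` — `Witness.upper`'s and `lf_nonneg`'s SHAPES, `lf` =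
  (41)'s non-trivial histories with the constants pulled out.
* §3 ★★★ `twoSidedRep_of_alpha` — both, packaged as `∃ lf ≥ 0, (lower on the window) ∧ (upper everywhere)`.

WHAT THIS FILE IS NOT (§69.2 by name): `lf_le`∕`large` (Sect. D small factors: the LF debt δ9–δ10, px10 g19 §45), `isBackground` (δ2), `cover`∕`diam_foot` (δ1∕δ4), a.e.→pointwise for the
ROUTE's chosen version (δ7 — this file takes the POINTWISE schemas `Ineq41At`∕`Ineq47At` as hypotheses; the package `AlphaInputsT3AC` carries only their a.e. forms), the `e^κ` normalisation of
S1a(ᴴ).  Nothing of Bałaban's is asserted or proved: the schemas are HYPOTHESES on a GIVEN `D`; S1a(ᴴ) ((m) AS TYPED misstated by currency, RULING №80; AS PRINTED OPEN), crux 20520 and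
`YM3TorusSU2` are NOT proved; no registered stub is closed; the Yang–Mills mass gap is NOT proved.  Sorry-free, axioms standard.

References: T. Bałaban, CMP **102** (1985) 255–275 [Balaban1985UV3] ((5) p.256, (41) p.266, (47) p.267, p.272).
-/

set_option autoImplicit false

noncomputable section

namespace Summit.QuantumFields.YangMills.Theorems.FluctuationComparisonRegPrIntLS1aAlphaTwoSidedRep

open MeasureTheory
open Literature.MathematicalPhysics.QuantumFieldTheory.Balaban1983to89
open T3ContinuumYM3Torus T3UnitScaleTilt T3UnitLawDensityEML T3RestrictedUnitDensity T3AlphaInputsAC T3AlphaInputsACSchemas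
open T3AlphaInputsACHistorySplit (low_mul_exp_le_up)

variable {F : T3Family} {γ : ℝ}

/-! ## §1 The lower clause from (47′) -/

/-- ★★ **`Witness.lower`'s SHAPE FROM (47′)**: under the pointwise (47′) `Ineq47At D K k`, the main-term identification `MainTermIsAction D` and «`χ_k = 1` on the `θBal(K−k)`-window»,
for every window datum `W`: `exp(−β_K·A(U_k(W)) + Pint(triv, W) + (−E_k) − Rm_k) ≤ ρ_k(W)` — the run's bare coefficient `β_K = (F.scheme ℰp γ).β K` on the unit-weight finest-lattice
action of the trivial-history minimiser, activities `Pint`, constant `−E_k`, slack `Rm_k`. [cite: Balaban1985UV3, (47) p.267] -/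
theorem lower_of_ineq47 (D : AlphaDataT3 F γ) {b₀ p₀ : ℝ} (K k : ℕ) (h47 : Ineq47At D K k) (hM : MainTermIsAction D)
    (hχ1 : ∀ W : GaugeField (F.P K) k (Matrix.specialUnitaryGroup (Fin 2) ℂ), PlaqSmall (θBal F.L γ b₀ p₀ (K - k)) W → D.χ K k W = 1)
    (W : GaugeField (F.P K) k (Matrix.specialUnitaryGroup (Fin 2) ℂ)) (hW : PlaqSmall (θBal F.L γ b₀ p₀ (K - k)) W) :
    Real.exp (-((F.scheme ℰp γ).β K * wilsonAction4 (D.Umin K k (D.triv K k) W)) + D.Pint K k (D.triv K k) W + (-D.Ecst K k) - D.Rm K k) ≤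
      resDensity F γ K Set.univ k W := by
  have h := h47 W
  have hlow : D.low K k W = Real.exp (-(D.mainT K k (D.triv K k) W) + D.Pint K k (D.triv K k) W) := by
    unfold AlphaDataT3.low; rw [hχ1 W hW, one_mul]
  rw [hlow, ← Real.exp_add, hM K k (D.triv K k) W] at h
  convert h using 2
  ring

/-! ## §2 The upper clause and `lf ≥ 0` from (41′) and the opened history functional -/

/-- ★★ **`Witness.upper`'s AND `lf_nonneg`'s SHAPES FROM (41′)**: under the pointwise (41′) `Ineq41At D K k`, `MainTermIsAction D`, `ChiRange D` and the opened history functional `LFSum D W`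
with the R0 clause («the trivial region history's weight is `χ_k`») and «`Zterm(triv) = 0`», for EVERY datum `W`:
`ρ_k(W) ≤ exp(−β_K·A(U_k(W)) + Pint(triv, W) + (−E_k) + Rm_k) + lf(W)` with `lf(W) := e^{−E_k + Rm_k}·(up_k(W) − low_k(W)) ≥ 0` — the non-trivial histories of (41) with the constants
pulled out. [cite: Balaban1985UV3, (41) p.266 and p.272] -/
theorem upper_of_ineq41 (D : AlphaDataT3 F γ) (Wd : LFData D) (K k : ℕ) (h41 : Ineq41At D K k) (hM : MainTermIsAction D) (hχ : ChiRange D) (hLF : LFSum D Wd)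
    (hR0 : ∀ (W : GaugeField (F.P K) k (Matrix.specialUnitaryGroup (Fin 2) ℂ)) v, Wd.wt K k (Wd.trivReg K k) v W = D.χ K k W)
    (hZ : D.Zterm K k (D.triv K k) = 0) (W : GaugeField (F.P K) k (Matrix.specialUnitaryGroup (Fin 2) ℂ)) :
    resDensity F γ K Set.univ k W ≤
        Real.exp (-((F.scheme ℰp γ).β K * wilsonAction4 (D.Umin K k (D.triv K k) W)) + D.Pint K k (D.triv K k) W + (-D.Ecst K k) + D.Rm K k) +
          Real.exp (-(D.Ecst K k) + D.Rm K k) * (D.up K k W - D.low K k W) ∧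
      0 ≤ Real.exp (-(D.Ecst K k) + D.Rm K k) * (D.up K k W - D.low K k W) := by
  have hle : D.low K k W ≤ D.up K k W := by
    have h := low_mul_exp_le_up hLF (hR0 W)
    rwa [hZ, Real.exp_zero, mul_one] at h
  refine ⟨?_, mul_nonneg (Real.exp_nonneg _) (sub_nonneg.mpr hle)⟩
  have h := h41 W
  -- `low ≤ exp(−mainT + Pint)` by `χ ≤ 1`
  have hlow : D.low K k W ≤ Real.exp (-(D.mainT K k (D.triv K k) W) + D.Pint K k (D.triv K k) W) := by
    unfold AlphaDataT3.low
    have h1 := (hχ K k W).2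
    have h0 := Real.exp_nonneg (-(D.mainT K k (D.triv K k) W) + D.Pint K k (D.triv K k) W)
    nlinarith
  have hE : 0 ≤ Real.exp (-(D.Ecst K k) + D.Rm K k) := Real.exp_nonneg _
  calc resDensity F γ K Set.univ k W ≤ Real.exp (-(D.Ecst K k) + D.Rm K k) * D.up K k W := h
    _ = Real.exp (-(D.Ecst K k) + D.Rm K k) * D.low K k W + Real.exp (-(D.Ecst K k) + D.Rm K k) * (D.up K k W - D.low K k W) := by ring
    _ ≤ Real.exp (-(D.Ecst K k) + D.Rm K k) * Real.exp (-(D.mainT K k (D.triv K k) W) + D.Pint K k (D.triv K k) W) +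
          Real.exp (-(D.Ecst K k) + D.Rm K k) * (D.up K k W - D.low K k W) := by gcongr
    _ = _ := by rw [← Real.exp_add, hM K k (D.triv K k) W]; ring_nf

/-! ## §3 The two-sided representation packaged in `Witness` shape -/

/-- ★★★ **THE (α)-SOCKET's TWO-SIDED REPRESENTATION AT THE TRIVIAL HISTORY, IN `BalabanUVClass.Witness` CURRENCY** (run `K`, level `k`): from the named schemas (47′)∕(41′) pointwise,
`MainTermIsAction`, `ChiRange`, `LFSum` + the three inline clauses (χ = 1 on the window; R0; `Zterm(triv) = 0`): `∃ lf ≥ 0` with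
`exp(−β_K·A(Umin W) + Pint(triv, W) + cst − slack) ≤ ρ_k(W)` on the `θBal(K−k)`-window and `ρ_k(W) ≤ exp(−β_K·A(Umin W) + Pint(triv, W) + cst + slack) + lf W` everywhere, `cst := −E_k`, `slack := Rm_k`,
`β_K := (F.scheme ℰp γ).β K` — the `lower`∕`upper`∕`lf_nonneg` clauses of a class witness for `ρ_k = resDensity F γ K univ k`, up to the fields this file does not build (UV3-NODE §69.2).
[cite: Balaban1985UV3, (41) p.266 and (47) p.267] -/
theorem twoSidedRep_of_alpha (D : AlphaDataT3 F γ) (Wd : LFData D) {b₀ p₀ : ℝ} (K k : ℕ) (h47 : Ineq47At D K k) (h41 : Ineq41At D K k)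
    (hM : MainTermIsAction D) (hχ : ChiRange D) (hLF : LFSum D Wd)
    (hχ1 : ∀ W : GaugeField (F.P K) k (Matrix.specialUnitaryGroup (Fin 2) ℂ), PlaqSmall (θBal F.L γ b₀ p₀ (K - k)) W → D.χ K k W = 1)
    (hR0 : ∀ (W : GaugeField (F.P K) k (Matrix.specialUnitaryGroup (Fin 2) ℂ)) v, Wd.wt K k (Wd.trivReg K k) v W = D.χ K k W)
    (hZ : D.Zterm K k (D.triv K k) = 0) :
    ∃ lf : GaugeField (F.P K) k (Matrix.specialUnitaryGroup (Fin 2) ℂ) → ℝ, (∀ W, 0 ≤ lf W) ∧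
      (∀ W, PlaqSmall (θBal F.L γ b₀ p₀ (K - k)) W →
        Real.exp (-((F.scheme ℰp γ).β K * wilsonAction4 (D.Umin K k (D.triv K k) W)) + D.Pint K k (D.triv K k) W + (-D.Ecst K k) - D.Rm K k) ≤
          resDensity F γ K Set.univ k W) ∧
      (∀ W, resDensity F γ K Set.univ k W ≤
        Real.exp (-((F.scheme ℰp γ).β K * wilsonAction4 (D.Umin K k (D.triv K k) W)) + D.Pint K k (D.triv K k) W + (-D.Ecst K k) + D.Rm K k) + lf W) :=
  ⟨fun W => Real.exp (-(D.Ecst K k) + D.Rm K k) * (D.up K k W - D.low K k W),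
    fun W => (upper_of_ineq41 D Wd K k h41 hM hχ hLF hR0 hZ W).2,
    fun W hW => lower_of_ineq47 D K k h47 hM hχ1 W hW,
    fun W => (upper_of_ineq41 D Wd K k h41 hM hχ hLF hR0 hZ W).1⟩

end Summit.QuantumFields.YangMills.Theorems.FluctuationComparisonRegPrIntLS1aAlphaTwoSidedRep

end
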